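import Summits.AtomisticToContinuum.Crystallization.Theses.PhononSlackCertificates
import Summits.AtomisticToContinuum.Crystallization.Theorems.ReggeStarCoercivityStarCoercivityCoarseTierTransfer

/-!
# Route `PhononSlackCertificates`, crux `CoerciveTwoShellGap` (stmt-AtomisticToContinuum-13956),
# line `Sketch`: stub `stub_periodisation` — TRANSFER TORUS → FINITE

If one `g > 0` charges every `1/20`-bad motif point of every periodic configuration `P` of `ℝ³`
with `1/3`-separated point set (`e* + g · #bad(P)/#motif ≤ e(P)`, badness of a motif point `y`
read in the infinite point set, `¬ IsTwoShellGoodSet (1/20) (47/50) 1 P.points y`,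
`e* = ⨅_Q e(Q)` the periodic Lennard-Jones infimum), then the same `g` charges every `1/20`-bad
index of every finite `1/3`-separated `x : Fin N → ℝ³`:
`N · e* + g · #{i : ¬ IsTwoShellGood (1/20) (47/50) 1 x i} ≤ E_LJ(x)`.

PROOF (periodisation; a port of `stub_coarseTierTransfer`, file
`ReggeStarCoercivityStarCoercivityCoarseTierTransfer.lean`, to the two-shell predicates).
For `N ≥ 1` take a periodic configuration `P` with motif `univ.image x` all of whose non-zero
periods have length `≥ 2Σ‖xᵢ‖ + 2` (`CoarseTierTransfer.exists_periodicConfiguration`).  Then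
`P.points` is `1/3`-separated (`separated_points`), `#motif = N`, `e(P) ≤ E_LJ(x)/N`
(`energyPerParticle_le`), and — the only new point — a set-goodness witness at `x i` in
`P.points` is a goodness witness of the index `i` in `x` (`isTwoShellGood_of_isTwoShellGoodSet`):
the matched points `f v` lie within `(1/20 + √2)·a < 2` of `x i`, while the points of `P` other
than the `x j` are at distance `≥ 2` (`two_le_dist_of_mem_points`), so `f v = x j` for a unique
`j =: f' v`; `f' v ≠ i` since `dist (x i) (x i + a • A v) = a‖v‖ ≥ a > a/20`; injectivity and
the two-way match transfer through `x ∘ f' = f`.  Hence `#bad(x) ≤ #bad motif points`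
(`card_bad_le`); feed `P` to the hypothesis and multiply by `N` (`mul_add_le_of_add_div_le`);
`N = 0` is trivial.  No definition, no named fact; all `[folklore]`.
-/

noncomputable section

namespace Summit.AtomisticToContinuum.Crystallization.Theorems.CoerciveTwoShellGapPeriodisation

open scoped BigOperators Classical
open Literature.MathematicalPhysics.StatisticalMechanics Literature.Geometry.DiscreteGeometry
open Summit.AtomisticToContinuum.Crystallization.Theorems.CoarseTierTransfer

-- adapted from Summits/.../ReggeStarCoercivityStarCoercivityCoarseTierTransfer.lean (stub_coarseTierTransfer)

variable {N : ℕ} {x : Fin N → EuclideanSpace ℝ (Fin 3)} {P : PeriodicConfiguration 3}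

/-- Every point of either two-shell pattern has norm at least `1` (the norms are `1` or `√2`).
[folklore] -/
theorem one_le_norm_of_mem_twoShellPattern {Pat : Finset (EuclideanSpace ℝ (Fin 3))}
    (hPat : Pat = fccTwoShellPattern ∨ Pat = hcpTwoShellPattern) {v : EuclideanSpace ℝ (Fin 3)}
    (hv : v ∈ Pat) : 1 ≤ ‖v‖ := by
  have h2 : (1 : ℝ) ≤ Real.sqrt 2 := Real.one_le_sqrt.mpr (by norm_num)
  rcases hPat with rfl | rfl
  · rcases norm_of_mem_fccTwoShellPattern hv with h | h
    · rw [h]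
    · rw [h]; exact h2
  · rcases norm_of_mem_hcpTwoShellPattern hv with h | h
    · rw [h]
    · rw [h]; exact h2

/-- **Transfer of goodness, set → index.**  For a periodisation `P` of the injective `x` (motif
`univ.image x`, non-zero periods of length `≥ 2Σ‖xᵢ‖ + 2`), a `1/20`-goodness witness of the
point `x i` in `P.points` is a `1/20`-goodness witness of the index `i` in `x`: the matched points
lie within `(1/20 + √2)·a < 2` of `x i`, hence are of the form `x j` (the other points of `P` are
at distance `≥ 2`), with `j` unique; `j ≠ i` because `a‖v‖ ≥ a > a/20`. [folklore] -/
theorem isTwoShellGood_of_isTwoShellGoodSet (hPm : P.motif = Finset.univ.image x)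
    (hPl : ∀ g ∈ P.lattice, g ≠ 0 → 2 * ∑ k, ‖x k‖ + 2 ≤ ‖g‖) (hx : Function.Injective x)
    (i : Fin N) (h : IsTwoShellGoodSet (1 / 20) (47 / 50) 1 P.points (x i)) :
    IsTwoShellGood (1 / 20) (47 / 50) 1 x i := by
  obtain ⟨a, ha₁, ha₂, A, Pat, f, hPat, hf, hinj, hcov⟩ := h
  have ha0 : 0 < a := lt_of_lt_of_le (by norm_num) ha₁
  have hsqrt : Real.sqrt 2 < 1415 / 1000 := by
    rw [Real.sqrt_lt' (by norm_num)]
    norm_num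
  -- the matched points are within `(1/20 + √2)·a < 2` of `x i`
  have hnear : ∀ v ∈ Pat, dist (x i) (f v) < 2 := by
    intro v hv
    have hAv : ‖a • A v‖ ≤ Real.sqrt 2 * a := by
      rw [norm_smul, Real.norm_of_nonneg ha0.le, A.norm_map, mul_comm]
      exact mul_le_mul_of_nonneg_right (norm_le_sqrt_two_of_mem_twoShellPattern hPat hv) ha0.le
    have h1 : dist (x i) (x i + a • A v) ≤ Real.sqrt 2 * a := by
      rwa [dist_comm, dist_eq_norm, add_sub_cancel_left]
    have h2 : dist (x i + a • A v) (f v) ≤ 1 / 20 * a := by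
      rw [dist_comm]
      exact (hf v hv).2
    have h3 : Real.sqrt 2 * a ≤ Real.sqrt 2 * 1 :=
      mul_le_mul_of_nonneg_left ha₂ (Real.sqrt_nonneg 2)
    linarith [dist_triangle (x i) (x i + a • A v) (f v)]
  -- hence they are of the form `x j`
  have hex : ∀ v ∈ Pat, ∃ j, x j = f v := by
    intro v hv
    by_contra hno
    push Not at hno
    have h2 := two_le_dist_of_mem_points hPm hPl i (hf v hv).1 fun j => (hno j).symm
    linarith [hnear v hv]
  -- and never `x i` itself
  have hne : ∀ v ∈ Pat, f v ≠ x i := by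
    intro v hv hfv
    have hv1 := one_le_norm_of_mem_twoShellPattern hPat hv
    have hd := (hf v hv).2
    rw [hfv, dist_comm, dist_eq_norm, add_sub_cancel_left, norm_smul, Real.norm_of_nonneg ha0.le,
      A.norm_map] at hd
    have h1 : a * 1 ≤ a * ‖v‖ := mul_le_mul_of_nonneg_left hv1 ha0.le
    linarith
  -- the index assignment `f'` with `x ∘ f' = f` on the pattern
  obtain ⟨f', hf'⟩ : ∃ f' : EuclideanSpace ℝ (Fin 3) → Fin N, ∀ v ∈ Pat, x (f' v) = f v :=
    ⟨fun v => if h : ∃ j, x j = f v then h.choose else i, fun v hv => by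
      simp only [dif_pos (hex v hv)]
      exact (hex v hv).choose_spec⟩
  refine ⟨a, ha₁, ha₂, A, Pat, f', hPat, fun v hv => ⟨?_, ?_⟩, ?_, ?_⟩
  · intro hfi
    exact hne v hv (by rw [← hf' v hv, hfi])
  · rw [hf' v hv]
    exact (hf v hv).2
  · intro v hv w hw hvw
    exact hinj hv hw (by rw [← hf' v hv, ← hf' w hw, hvw])
  · intro j hji hd
    have hjP : x j ∈ P.points := P.mem_points_of_mem_motif (by
      rw [hPm]; exact Finset.mem_image_of_mem x (Finset.mem_univ j))
    obtain ⟨v, hv, hfv⟩ := hcov (x j) hjP (hx.ne hji) hd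
    exact ⟨v, hv, hx (by rw [hf' v hv, hfv])⟩

/-- **The bad indices of `x` are counted by the bad motif points of its periodisation `P`**:
`#{i : ¬ IsTwoShellGood (1/20) (47/50) 1 x i} ≤ #{y ∈ motif : ¬ IsTwoShellGoodSet (1/20) (47/50) 1 P.points y}`
(motif `= univ.image x`, `x` injective, `isTwoShellGood_of_isTwoShellGoodSet`). [folklore] -/
theorem card_bad_le (hPm : P.motif = Finset.univ.image x)
    (hPl : ∀ g ∈ P.lattice, g ≠ 0 → 2 * ∑ k, ‖x k‖ + 2 ≤ ‖g‖) (hx : Function.Injective x) :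
    Nat.card {i : Fin N // ¬ IsTwoShellGood (1 / 20) (47 / 50) 1 x i} ≤
      (P.motif.filter fun y => ¬ IsTwoShellGoodSet (1 / 20) (47 / 50) 1 P.points y).card := by
  have hPm' : P.motif = Finset.univ.image x := hPm
  rw [hPm', Finset.filter_image, Finset.card_image_of_injective _ hx, Nat.card_eq_fintype_card,
    Fintype.card_subtype]
  refine Finset.card_le_card fun i => ?_
  simp only [Finset.mem_filter, Finset.mem_univ, true_and]
  exact fun h hset => h (isTwoShellGood_of_isTwoShellGoodSet hPm hPl hx i hset)

/-- **Stub `stub_periodisation` — transfer torus → finite** of line `Sketch` (crux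
`PhononSlackCertificates.CoerciveTwoShellGap`, item 13956).  If some `g > 0` charges every
`1/20`-bad motif point of every periodic configuration of `ℝ³` with `1/3`-separated point set
(`e* + g · #bad/#motif ≤ e(P)`, badness read in `P.points` through `IsTwoShellGoodSet`), then the
same `g` gives, for every `1/3`-separated finite `x : Fin N → ℝ³`,
`N · e* + g · #{i : ¬ IsTwoShellGood (1/20) (47/50) 1 x i} ≤ E_LJ(x)`.
Proof: apply the hypothesis to a periodisation of `x` with periods `≥ 2Σ‖xᵢ‖ + 2` (separated,
`#bad(x) ≤ #bad motif points` by `card_bad_le`, `#motif = N`, `e(P) ≤ E_LJ(x)/N`) and multiply by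
`N`; `N = 0` is trivial. [folklore] -/
theorem stub_periodisation :
    (∃ g : ℝ, 0 < g ∧ ∀ P : PeriodicConfiguration 3,
        (∀ u ∈ P.points, ∀ v ∈ P.points, u ≠ v → (1 / 3 : ℝ) ≤ dist u v) →
        (⨅ Q : PeriodicConfiguration 3, Q.energyPerParticle lennardJones)
          + g * ((P.motif.filter fun y => ¬ IsTwoShellGoodSet (1 / 20) (47 / 50) 1 P.points y).card : ℝ)
              / (P.motif.card : ℝ)
          ≤ P.energyPerParticle lennardJones) →
    ∃ g : ℝ, 0 < g ∧ ∀ (N : ℕ) (x : Fin N → EuclideanSpace ℝ (Fin 3)),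
        (∀ i j : Fin N, i ≠ j → (1 / 3 : ℝ) ≤ dist (x i) (x j)) →
        (N : ℝ) * (⨅ Q : PeriodicConfiguration 3, Q.energyPerParticle lennardJones)
          + g * (Nat.card {i : Fin N // ¬ IsTwoShellGood (1 / 20) (47 / 50) 1 x i} : ℝ)
          ≤ interactionEnergy lennardJones x := by
  rintro ⟨g, hg, hP⟩
  refine ⟨g, hg, fun N x hsep => ?_⟩
  rcases Nat.eq_zero_or_pos N with rfl | hN
  · simp [interactionEnergy]
  · have hx : Function.Injective x := injective_of_separated hsep
    obtain ⟨P, hPm, hPl⟩ := exists_periodicConfiguration x hN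
    have key := hP P (separated_points hPm hPl hsep)
    have hcardm : (P.motif.card : ℝ) = N := by
      rw [hPm, Finset.card_image_of_injective _ hx]
      simp
    rw [hcardm] at key
    have hcnt : (Nat.card {i : Fin N // ¬ IsTwoShellGood (1 / 20) (47 / 50) 1 x i} : ℝ) ≤
        ((P.motif.filter fun y => ¬ IsTwoShellGoodSet (1 / 20) (47 / 50) 1 P.points y).card : ℝ) := by
      exact_mod_cast card_bad_le hPm hPl hx
    have h2 := energyPerParticle_le hPm hPl hx hN
    have hNr : (0 : ℝ) < N := by exact_mod_cast hN
    refine mul_add_le_of_add_div_le hNr (le_trans ?_ (key.trans h2))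
    have h3 : g * (Nat.card {i : Fin N // ¬ IsTwoShellGood (1 / 20) (47 / 50) 1 x i} : ℝ) / N ≤
        g * ((P.motif.filter fun y => ¬ IsTwoShellGoodSet (1 / 20) (47 / 50) 1 P.points y).card : ℝ)
          / N :=
      div_le_div_of_nonneg_right (mul_le_mul_of_nonneg_left hcnt hg.le) hNr.le
    linarith

end Summit.AtomisticToContinuum.Crystallization.Theorems.CoerciveTwoShellGapPeriodisation

end
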